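import Literature.NumberTheory.GaloisRepresentations.ArchimedeanHerbrand
import Literature.NumberTheory.GaloisRepresentations.SemiLocalUnitGroupShapiro
import HarnessLib

/-!
# The archimedean semi-local module `∏_{w ∣ v} E_wˣ` (`v` an infinite place) is co-induced from the
# decomposition group; Shapiro `Hⁿ(Gal(E/F), ∏_{w ∣ v} E_wˣ) ≅ Hⁿ(G_w, E_wˣ)`, and `= 0` (`n ≥ 1`) at an
# unramified infinite place (Harari Prop. 13.1 (b) at the archimedean places; Tate, C–F VII §7.2)

Topic `NumberTheory/GaloisRepresentations`; namespace `Literature.NumberTheory.GaloisRepresentations.ArchHerbrand`,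
continuing `ArchimedeanHerbrand.lean` (the `Gal(E/F)`-stable subgroup `infUnits E v ≤ E_∞ˣ` of archimedean idèles
supported above the infinite place `v` of `F` — Childress's `∏_{w∣v} 𝒰_w`; `smul_units_apply`,
`isStable_infUnits`, `galInfiniteCompletionMap`) and the finite-place files `SemiLocalShapiro` /
`SemiLocalUnitGroupShapiro` (whose pattern — Brown III (5.8) via the engine's
`CoinducedModule.corecognitionIso`, then Mathlib's `groupCohomology.coindIso` — is repeated here).  Definitions
with bodies (the two representations, the projections, the isomorphisms) and theorems; NO named fact, no
`sorry`, no instance, no notation; fields in `Type`, no number-field hypothesis needed.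

Mathematics (Harari §13.1, archimedean `v`; Tate VII §7.2): for `E/F` Galois with group `G` and an infinite
place `w₀` of `E` over `v = w₀|_F`, the places of `E` over `v` form the orbit `G·w₀` (Mathlib
`InfinitePlace.exists_smul_eq_of_comap_eq`), `∏_{w∣v} E_wˣ = infUnits E v` is the direct product of the
`E_wˣ`, `w ∈ G·w₀`, permuted transitively by `G`, hence `≅ Coind_{G_{w₀}}^G E_{w₀}ˣ` with `G_{w₀} = Stab(w₀)`
(of order `1` or `2`) acting on `E_{w₀} ∈ {ℝ, ℂ}` through `galInfiniteCompletionMap`; Shapiro gives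
`Hⁿ(G, ∏_{w∣v} E_wˣ) ≅ Hⁿ(G_{w₀}, E_{w₀}ˣ)`, which vanishes for `n ≥ 1` when `w₀` is unramified over `F`
(`Stab(w₀) = 1`, Mathlib `IsUnramified.stabilizer_eq_bot`).

## What is formalised (`F E : Type` fields, `[IsGalois F E]` where marked, `w₀ : InfinitePlace E`, `v := w₀.comap (algebraMap F E)`)

* §1 `isOver_comap_iff_mem_orbit` (`w ∣ v ↔ w ∈ G·w₀`).
* §2 `archLocalUnitsRepr / archLocalUnitsRep w₀ : Rep ℤ Stab(w₀)` on `Additive (E_{w₀}ˣ)` (transport action).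
* §3 `archUnitsRepr / archUnitsRep v : Rep ℤ G` on `Additive (infUnits E v)` (`Herbrand.stableRepr`), the component
  projections `archProj v w`, `ker_archProj_smul` (`G` permutes the factors), **`bijective_pi_archProj`** (direct
  product over the orbit), `surjective_archProj`, `basePt`, `stabilizer_basePt`.
* §4 `costabilizerRep_arch_apply`, **`archUnitsRepIsoCoind`** (`∏_{w∣v} E_wˣ ≅ Coind E_{w₀}ˣ`),
  **`groupCohomologyArchUnitsRepIso w₀ n : Hⁿ(G, ∏_{w∣v} E_wˣ) ≅ Hⁿ(Stab(w₀), E_{w₀}ˣ)`** (Shapiro, then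
  `groupCohomology.mapIso` along `Stab(basePt) = Stab(w₀)`).
* §5 **`isZero_groupCohomology_archLocalUnitsRep`**, **`isZero_groupCohomology_archUnitsRep`**: `= 0` in degrees
  `≥ 1` when `w₀` is unramified over `F` (trivial decomposition group).

Not here: the ramified (real-under-complex) case `Stab(w₀) = {1, c}` (`Ĥ⁰ = ℤ/2`, `H¹ = 0`, `H² = ℤ/2` — the
tree's `h0_infUnits_eq_card_stabilizer` in Herbrand form), Tate degrees `≤ 0`, and the identification of
`E_{w₀}` with `ℝ`/`ℂ` as a `Stab(w₀)`-field.

## References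
* D. Harari, *Galois Cohomology and Class Field Theory*, Springer (2020), §13.1 (proof of Prop. 13.1 (b),
  all places). [Harari2020]
* J. W. S. Cassels, A. Fröhlich (eds.), *Algebraic Number Theory* (1967), Ch. VII (Tate) §1.1, §7.2.
  [CasselsFrohlichANT1967]
* K. S. Brown, *Cohomology of Groups*, GTM 87 (1982), III (5.8), (6.2). [Brown1982CohomologyGroups]
* N. Childress, *Class Field Theory* (2009), Ch. 4 §5 Prop. 5.7 (i)–(ii). [Childress2009]
-/

noncomputable section

open NumberField NumberField.InfinitePlace CategoryTheory CategoryTheory.Limits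
open Literature.NumberTheory.Automorphic
open scoped Classical

namespace Literature.NumberTheory.GaloisRepresentations

namespace ArchHerbrand

open Literature.Algebra.Homology

variable {F : Type} [Field F] {E : Type} [Field E] [Algebra F E]

/-! ## §1. The places over `v = w₀|_F` are the orbit of `w₀` -/

/-- **`w ∣ v ↔ w ∈ G·w₀`** for `v = w₀|_F` (`Gal(E/F)` is transitive on the infinite places over `v`).
[cite: CasselsFrohlichANT1967, Ch. VII §1.1] -/
theorem isOver_comap_iff_mem_orbit [IsGalois F E] (w₀ w : InfinitePlace E) :
    IsOver E (w₀.comap (algebraMap F E)) w ↔ w ∈ MulAction.orbit (E ≃ₐ[F] E) w₀ := by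
  constructor
  · intro h
    obtain ⟨σ, hσ⟩ := InfinitePlace.exists_smul_eq_of_comap_eq (k := F) (w := w₀) (w' := w) h.symm
    exact ⟨σ, hσ⟩
  · rintro ⟨σ, rfl⟩
    exact (isOver_smul_iff σ).mpr rfl

/-! ## §2. The decomposition group `Stab(w₀)` acting on `E_{w₀}ˣ` -/

/-- An element of `Stab(w₀)` fixes `w₀`. [cite: CasselsFrohlichANT1967, Ch. VII §1.1] -/
theorem coe_stabilizer_smul (w₀ : InfinitePlace E)
    (g : MulAction.stabilizer (E ≃ₐ[F] E) w₀) : (g : E ≃ₐ[F] E) • w₀ = w₀ :=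
  MulAction.mem_stabilizer_iff.mp g.2

/-- **The `Stab(w₀)`-module `E_{w₀}ˣ`** (additively): `g ↦ g_{w₀}` on units (`galInfiniteCompletionMap g` at
`g w₀ = w₀`; cocycle law `galInfiniteCompletionMap_galInfiniteCompletionMap`). [cite: Harari2020, §13.1 (the `G_v`-modules `K_v^*`)] -/
def archLocalUnitsRepr (w₀ : InfinitePlace E) :
    Representation ℤ (MulAction.stabilizer (E ≃ₐ[F] E) w₀) (Additive (w₀.Completion)ˣ) where
  toFun g := (MonoidHom.toAdditive (Units.map
    (galInfiniteCompletionMap (g : E ≃ₐ[F] E) (coe_stabilizer_smul w₀ g)).toMonoidHom)).toIntLinearMap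
  map_one' := LinearMap.ext fun x => by
    apply Additive.toMul.injective
    refine Units.ext ?_
    change galInfiniteCompletionMap ((1 : MulAction.stabilizer (E ≃ₐ[F] E) w₀) : E ≃ₐ[F] E) _
      ((Additive.toMul x : (w₀.Completion)ˣ) : w₀.Completion) = ((Additive.toMul x : (w₀.Completion)ˣ) : w₀.Completion)
    exact (galInfiniteCompletionMap_congr_left F (OneMemClass.coe_one _) _ (one_smul _ _) _).trans
      (galInfiniteCompletionMap_one F _ _)
  map_mul' g g' := LinearMap.ext fun x => by
    apply Additive.toMul.injective
    refine Units.ext ?_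
    change galInfiniteCompletionMap ((g * g' : MulAction.stabilizer (E ≃ₐ[F] E) w₀) : E ≃ₐ[F] E) _
      ((Additive.toMul x : (w₀.Completion)ˣ) : w₀.Completion) =
      galInfiniteCompletionMap (g : E ≃ₐ[F] E) (coe_stabilizer_smul w₀ g)
        (galInfiniteCompletionMap (g' : E ≃ₐ[F] E) (coe_stabilizer_smul w₀ g')
          ((Additive.toMul x : (w₀.Completion)ˣ) : w₀.Completion))
    rw [galInfiniteCompletionMap_galInfiniteCompletionMap]
    exact galInfiniteCompletionMap_congr_left F (Subgroup.coe_mul _ g g') _ _ _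

/-- The `Stab(w₀)`-module `E_{w₀}ˣ` as an object of `Rep ℤ Stab(w₀)`. [cite: Harari2020, §13.1] -/
def archLocalUnitsRep (w₀ : InfinitePlace E) : Rep ℤ (MulAction.stabilizer (E ≃ₐ[F] E) w₀) :=
  Rep.of (archLocalUnitsRepr (F := F) w₀)

/-- The action read in `E_{w₀}`: `g • u = g_{w₀}(u)`. [cite: Harari2020, §13.1] -/
theorem coe_toMul_archLocalUnitsRepr (w₀ : InfinitePlace E) (g : MulAction.stabilizer (E ≃ₐ[F] E) w₀)
    (x : Additive (w₀.Completion)ˣ) :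
    ((Additive.toMul (archLocalUnitsRepr (F := F) w₀ g x) : (w₀.Completion)ˣ) : w₀.Completion) =
      galInfiniteCompletionMap (g : E ≃ₐ[F] E) (coe_stabilizer_smul w₀ g)
        ((Additive.toMul x : (w₀.Completion)ˣ) : w₀.Completion) := rfl

/-! ## §3. `∏_{w ∣ v} E_wˣ = infUnits E v` as a `G`-module and its component projections -/

/-- The `G`-action on `∏_{w∣v} E_wˣ = infUnits E v` as a bare representation (`Herbrand.stableRepr` with
`isStable_infUnits`). [cite: Harari2020, §13.1 (the `G`-module `I_K(v)`)] -/
abbrev archUnitsRepr (v : InfinitePlace F) : Representation ℤ (E ≃ₐ[F] E) (Additive (infUnits E v)) :=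
  Herbrand.stableRepr (MulDistribMulAction.toMulAut (E ≃ₐ[F] E) (InfiniteAdeleRing E)ˣ) (infUnits E v)
    (fun σ _ hx => isStable_infUnits v σ hx)

/-- **The `G`-module `I_E(v) = ∏_{w ∣ v} E_wˣ` at an infinite place `v`** (additively, `Rep ℤ Gal(E/F)`).
[cite: Harari2020, §13.1 (the `G`-module `I_K(v)`)] -/
def archUnitsRep (v : InfinitePlace F) : Rep ℤ (E ≃ₐ[F] E) := Rep.of (archUnitsRepr (E := E) v)

/-- The component projection `∏_{w'∣v} E_{w'}ˣ → E_wˣ` at an infinite place `w` of `E` (components of an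
archimedean idèle are units). [cite: Brown1982CohomologyGroups, III §5 Prop. (5.8)] -/
def archProjHom (v : InfinitePlace F) (w : InfinitePlace E) : infUnits E v →* (w.Completion)ˣ where
  toFun u := Units.mk0 (((u : (InfiniteAdeleRing E)ˣ) : InfiniteAdeleRing E) w) (apply_ne_zero _ w)
  map_one' := Units.ext rfl
  map_mul' _ _ := Units.ext rfl

/-- The component projection, additively and `ℤ`-linearly (Brown's `π_w`). [cite: Brown1982CohomologyGroups, III §5 Prop. (5.8)] -/
def archProj (v : InfinitePlace F) (w : InfinitePlace E) : Additive (infUnits E v) →ₗ[ℤ] Additive (w.Completion)ˣ :=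
  (MonoidHom.toAdditive (archProjHom (E := E) v w)).toIntLinearMap

/-- `archProj v w u` read in `E_w` is the `w`-component of `u`. [cite: Brown1982CohomologyGroups, III §5 Prop. (5.8)] -/
theorem coe_toMul_archProj (v : InfinitePlace F) (w : InfinitePlace E) (x : Additive (infUnits E v)) :
    ((Additive.toMul (archProj (E := E) v w x) : (w.Completion)ˣ) : w.Completion) =
      (((Additive.toMul x : infUnits E v) : (InfiniteAdeleRing E)ˣ) : InfiniteAdeleRing E) w := rfl

/-- `u ∈ ker π_w` iff the `w`-component of `u` is `1`. [cite: Brown1982CohomologyGroups, III §5 Prop. (5.8)] -/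
theorem archProj_eq_zero_iff (v : InfinitePlace F) (w : InfinitePlace E) (x : Additive (infUnits E v)) :
    archProj (E := E) v w x = 0 ↔ (((Additive.toMul x : infUnits E v) : (InfiniteAdeleRing E)ˣ) : InfiniteAdeleRing E) w = 1 := by
  rw [← coe_toMul_archProj]
  refine ⟨fun h => by rw [h]; rfl, fun h => ?_⟩
  apply Additive.toMul.injective
  exact Units.ext h

/-- **`G` permutes the factors**: `ker (π_{g w} ∘ g) = ker π_w` (`(g u)_{g w} = g_w(u_w)`, `smul_units_apply`).
[cite: Brown1982CohomologyGroups, III §5 Prop. (5.8)] -/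
theorem ker_archProj_smul (v : InfinitePlace F) (g : E ≃ₐ[F] E) (w : InfinitePlace E) :
    LinearMap.ker (archProj (E := E) v (g • w) ∘ₗ archUnitsRepr (E := E) v g) = LinearMap.ker (archProj (E := E) v w) := by
  ext x
  simp only [LinearMap.mem_ker, LinearMap.comp_apply, archProj_eq_zero_iff]
  rw [Herbrand.coe_toMul_stableRepr, MulDistribMulAction.toMulAut_apply, MulDistribMulAction.toMulEquiv_apply,
    smul_units_apply, galInfiniteCompletionMap_apply_congr_place (F := F) (E := E) (inv_smul_smul g w) _ (rfl : g • w = g • w),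
    map_eq_one_iff _ (galInfiniteCompletionMap _ _).injective]

/-- **Direct product decomposition `∏_{w∣v} E_wˣ ≅ ∏_{w ∈ G·w₀} E_wˣ`** by the component projections
(`v = w₀|_F`; an element of `infUnits E v` is `1` off the places over `v`). [cite: Brown1982CohomologyGroups, III §5 Prop. (5.8)] -/
theorem bijective_pi_archProj [IsGalois F E] (w₀ : InfinitePlace E) :
    Function.Bijective (LinearMap.pi (fun w : MulAction.orbit (E ≃ₐ[F] E) w₀ =>
      archProj (E := E) (w₀.comap (algebraMap F E)) (w : InfinitePlace E))) := by
  set v := w₀.comap (algebraMap F E)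
  constructor
  · intro x y h
    have h' : ∀ w : MulAction.orbit (E ≃ₐ[F] E) w₀,
        archProj (E := E) v (w : InfinitePlace E) x = archProj (E := E) v (w : InfinitePlace E) y := fun w => congr_fun h w
    apply Additive.toMul.injective
    refine Subtype.ext (Units.ext (funext fun w => ?_))
    by_cases hw : IsOver E v w
    · have hmem : w ∈ MulAction.orbit (E ≃ₐ[F] E) w₀ := (isOver_comap_iff_mem_orbit w₀ w).mp hw
      have := congrArg (fun u => ((Additive.toMul u : ((w : InfinitePlace E).Completion)ˣ) : w.Completion)) (h' ⟨w, hmem⟩)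
      simpa only [coe_toMul_archProj] using this
    · rw [(Additive.toMul x).2 w hw, (Additive.toMul y).2 w hw]
  · intro f
    let x : InfiniteAdeleRing E := fun w =>
      if h : w ∈ MulAction.orbit (E ≃ₐ[F] E) w₀ then ((Additive.toMul (f ⟨w, h⟩) : (w.Completion)ˣ) : w.Completion) else 1
    have hx : ∀ w, x w ≠ 0 := fun w => by
      by_cases h : w ∈ MulAction.orbit (E ≃ₐ[F] E) w₀
      · simp only [x, dif_pos h]; exact Units.ne_zero _
      · simp only [x, dif_neg h]; exact one_ne_zero
    have hu := isUnit_of_forall_ne_zero (E := E) hx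
    have hmem : hu.unit ∈ infUnits E v := fun w hw => by
      rw [IsUnit.unit_spec]
      simp only [x, dif_neg (mt (isOver_comap_iff_mem_orbit w₀ w).mpr hw)]
    refine ⟨Additive.ofMul ⟨hu.unit, hmem⟩, funext fun w => ?_⟩
    apply Additive.toMul.injective
    refine Units.ext ?_
    rw [LinearMap.pi_apply, coe_toMul_archProj, toMul_ofMul]
    change x w = _
    simp only [x, dif_pos w.2]

/-- Each component projection over the orbit is onto. [cite: Brown1982CohomologyGroups, III §5 Prop. (5.8)] -/
theorem surjective_archProj [IsGalois F E] (w₀ : InfinitePlace E) (w : MulAction.orbit (E ≃ₐ[F] E) w₀) :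
    Function.Surjective (archProj (E := E) (w₀.comap (algebraMap F E)) (w : InfinitePlace E)) :=
  CoinducedModule.surjective_of_bijective_pi
    (fun w : MulAction.orbit (E ≃ₐ[F] E) w₀ => archProj (E := E) (w₀.comap (algebraMap F E)) (w : InfinitePlace E))
    (bijective_pi_archProj w₀) w

/-- The base point `w₀` of the orbit `G·w₀`. [cite: CasselsFrohlichANT1967, Ch. VII §1.1] -/
abbrev basePt (w₀ : InfinitePlace E) : MulAction.orbit (E ≃ₐ[F] E) w₀ := ⟨w₀, MulAction.mem_orbit_self w₀⟩

/-- `Stab(w₀ ∈ G·w₀) = Stab(w₀)`. [cite: CasselsFrohlichANT1967, Ch. VII §1.1] -/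
theorem stabilizer_basePt (w₀ : InfinitePlace E) :
    MulAction.stabilizer (E ≃ₐ[F] E) (basePt (F := F) w₀) = MulAction.stabilizer (E ≃ₐ[F] E) w₀ :=
  Subgroup.ext fun g => by
    simp only [MulAction.mem_stabilizer_iff, Subtype.ext_iff, MulAction.orbit.coe_smul]

/-- `ker_archProj_smul` indexed by the orbit. [cite: Brown1982CohomologyGroups, III §5 Prop. (5.8)] -/
theorem ker_archProj_smul_orbit [IsGalois F E] (w₀ : InfinitePlace E) (g : E ≃ₐ[F] E)
    (w : MulAction.orbit (E ≃ₐ[F] E) w₀) :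
    LinearMap.ker (archProj (E := E) (w₀.comap (algebraMap F E)) ((g • w : MulAction.orbit (E ≃ₐ[F] E) w₀) : InfinitePlace E)
      ∘ₗ archUnitsRepr (E := E) (w₀.comap (algebraMap F E)) g) =
      LinearMap.ker (archProj (E := E) (w₀.comap (algebraMap F E)) (w : InfinitePlace E)) := by
  rw [MulAction.orbit.coe_smul]
  exact ker_archProj_smul _ g w


/-! ## §4. `∏_{w ∣ v} E_wˣ ≅ Coind_{Stab(w₀)}^G E_{w₀}ˣ` and Shapiro -/

/-- **The `Stab`-structure on `E_{w₀}ˣ` inherited from `∏ E_wˣ` IS the transport action** (`(h u)_{w₀} = h_{w₀}(u_{w₀})`),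
along `Stab(w₀ ∈ G·w₀) = Stab(w₀)`. [cite: Brown1982CohomologyGroups, III §5 Prop. (5.8)] -/
theorem costabilizerRep_arch_apply [IsGalois F E] (w₀ : InfinitePlace E)
    (g : MulAction.stabilizer (E ≃ₐ[F] E) (basePt (F := F) w₀)) (x : Additive (w₀.Completion)ˣ) :
    CoinducedModule.costabilizerRep (archUnitsRepr (E := E) (w₀.comap (algebraMap F E)))
      (fun w : MulAction.orbit (E ≃ₐ[F] E) w₀ => archProj (E := E) (w₀.comap (algebraMap F E)) (w : InfinitePlace E))
      (basePt (F := F) w₀) (surjective_archProj w₀ _) (ker_archProj_smul_orbit w₀) g x =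
      archLocalUnitsRepr (F := F) w₀ (MulEquiv.subgroupCongr (stabilizer_basePt (F := F) w₀) g) x := by
  obtain ⟨y, rfl⟩ := surjective_archProj w₀ (basePt (F := F) w₀) x
  rw [CoinducedModule.costabilizerRep_proj]
  apply Additive.toMul.injective
  refine Units.ext ?_
  rw [coe_toMul_archProj, coe_toMul_archLocalUnitsRepr, coe_toMul_archProj, Herbrand.coe_toMul_stableRepr,
    MulDistribMulAction.toMulAut_apply, MulDistribMulAction.toMulEquiv_apply, smul_units_apply]
  exact galInfiniteCompletionMap_apply_congr_place (F := F) (E := E)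
    (inv_smul_eq_iff.mpr (MulAction.mem_stabilizer_iff.mp
      ((MulEquiv.subgroupCongr (stabilizer_basePt (F := F) w₀) g).2)).symm) _ _ _

/-- **`∏_{w ∣ v} E_wˣ ≅ Coind_{Stab(w₀)}^G E_{w₀}ˣ`** at an infinite place (Harari: "`I_K(v)` identifies with the
induced module `I_G^{G_v}(K_v^*)`", archimedean `v`; Brown III (5.8) via the engine's `corecognitionIso`).
[cite: Harari2020, §13.1 (before Prop. 13.1)] -/
def archUnitsRepIsoCoind [IsGalois F E] (w₀ : InfinitePlace E) :
    archUnitsRep (E := E) (w₀.comap (algebraMap F E)) ≅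
      Rep.coind (MulAction.stabilizer (E ≃ₐ[F] E) (basePt (F := F) w₀)).subtype
        (Rep.of (CoinducedModule.costabilizerRep (archUnitsRepr (E := E) (w₀.comap (algebraMap F E)))
          (fun w : MulAction.orbit (E ≃ₐ[F] E) w₀ => archProj (E := E) (w₀.comap (algebraMap F E)) (w : InfinitePlace E))
          (basePt (F := F) w₀) (surjective_archProj w₀ _) (ker_archProj_smul_orbit w₀))) :=
  CoinducedModule.corecognitionIso (archUnitsRepr (E := E) (w₀.comap (algebraMap F E)))
    (fun w : MulAction.orbit (E ≃ₐ[F] E) w₀ => archProj (E := E) (w₀.comap (algebraMap F E)) (w : InfinitePlace E))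
    (basePt (F := F) w₀) (surjective_archProj w₀ _) (ker_archProj_smul_orbit w₀) (bijective_pi_archProj w₀)

/-- **Shapiro at an infinite place: `Hⁿ(Gal(E/F), ∏_{w ∣ v} E_wˣ) ≅ Hⁿ(Stab(w₀), E_{w₀}ˣ)`**, `v = w₀|_F`
(Mathlib `groupCohomology.coindIso`, then `groupCohomology.mapIso` along `Stab(basePt) = Stab(w₀)`; for any
`Fintype` structure on `Gal(E/F)`). [cite: Harari2020, §13.1 Prop. 13.1 (b) (proof)] -/
def groupCohomologyArchUnitsRepIso [IsGalois F E] [Fintype (E ≃ₐ[F] E)] (w₀ : InfinitePlace E) (n : ℕ) :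
    groupCohomology (archUnitsRep (E := E) (w₀.comap (algebraMap F E))) n ≅
      groupCohomology (archLocalUnitsRep (F := F) w₀) n :=
  (groupCohomology.functor ℤ (E ≃ₐ[F] E) n).mapIso (archUnitsRepIsoCoind w₀) ≪≫
    groupCohomology.coindIso _ n ≪≫
    groupCohomology.mapIso (MulEquiv.subgroupCongr (stabilizer_basePt (F := F) w₀)) (LinearEquiv.refl ℤ _)
      (fun g => LinearMap.ext fun x => costabilizerRep_arch_apply w₀ g x) n

/-! ## §5. Unramified infinite places -/

/-- **At an unramified infinite place `Hⁿ(Stab(w₀), E_{w₀}ˣ) = 0` for `n ≥ 1`** (the decomposition group is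
trivial, Mathlib `IsUnramified.stabilizer_eq_bot`, `isZero_groupCohomology_succ_of_subsingleton`).
[cite: Harari2020, §13.1 Prop. 13.1 (b) (proof)] -/
theorem isZero_groupCohomology_archLocalUnitsRep [IsGalois F E] (w₀ : InfinitePlace E)
    (hw : InfinitePlace.IsUnramified F w₀) (n : ℕ) :
    IsZero (groupCohomology (archLocalUnitsRep (F := F) w₀) (n + 1)) := by
  haveI : Subsingleton (MulAction.stabilizer (E ≃ₐ[F] E) w₀) := by
    rw [hw.stabilizer_eq_bot]
    infer_instance
  exact isZero_groupCohomology_succ_of_subsingleton _ n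

/-- **`Hⁿ(Gal(E/F), ∏_{w ∣ v} E_wˣ) = 0` for `n ≥ 1` at an infinite place `v = w₀|_F` with `w₀` unramified over `F`**
(Shapiro + §5). [cite: Harari2020, §13.1 Prop. 13.1 (b) (proof)][cite: CasselsFrohlichANT1967, Ch. VII §7.2] -/
theorem isZero_groupCohomology_archUnitsRep [IsGalois F E] [Fintype (E ≃ₐ[F] E)] (w₀ : InfinitePlace E)
    (hw : InfinitePlace.IsUnramified F w₀) (n : ℕ) :
    IsZero (groupCohomology (archUnitsRep (E := E) (w₀.comap (algebraMap F E))) (n + 1)) :=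
  (isZero_groupCohomology_archLocalUnitsRep w₀ hw n).of_iso (groupCohomologyArchUnitsRepIso w₀ (n + 1))

end ArchHerbrand
end Literature.NumberTheory.GaloisRepresentations

end
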